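import Literature.NumberTheory.LFunctions.KadiriNumerics3Round1C
import Literature.NumberTheory.LFunctions.KadiriNumerics3Round2C
import Literature.NumberTheory.LFunctions.KadiriNumerics3Round3C
import Literature.NumberTheory.LFunctions.KadiriNumerics3Round4C
import Literature.NumberTheory.LFunctions.RiemannHypothesisUpTo101
import HarnessLib

/-!
# The large-height part of the Mossinghoff–Trudgian–Yang zero-free region, unconditionally

Topic `Literature/NumberTheory/LFunctions`. Everything in this file is PROVED. It discharges the
named fact `zero_free_region_mossinghoff_trudgian_yang_large_height` of `ExplicitZeroFreeRegion.lean`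
(leaf (B) of Theorem 1.3 of Mossinghoff–Trudgian–Yang, *Res. Number Theory* 10 (2024) =
arXiv:2212.06867, §9: `ζ(σ + it) ≠ 0` for `t > 3·10¹²`, `σ ≥ 1 − 1/(5.558691 log t)`) WITHOUT the
numerical verification of the Riemann hypothesis to height `3·10¹²` (Platt–Trudgian), on which the
printed proof and the tree's earlier assembly `KadiriNumericsFinal.lean`
(`…_large_height_of_numerical_rh`) rely. The printed method (Kadiri 2005 as optimised by
Mossinghoff–Trudgian 2015) uses that verification in three places: (i) the zeros within the
splitting height `t₀` of the real point `s = σ` (`k = 0` in the trigonometric inequality) are on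
the critical line; (ii) `ζ(σ) ≠ 0`; (iii) the region of each round is extended below `T₀` to all
heights `|t| ≥ 2` for the next round. Here (iii) is replaced by regions ABOVE A HEIGHT (the round
at the threshold `T` only needs the previous region above `T − t₀`, `KadiriStrip3.strip_empty`,
`KadiriStripEmptiness3.lean`), the initial region being the tree's crude explicit region
`1 − β ≥ 1/((4480 + 74172/log T) log γ)` above `T = 3·10¹² − 400` (constant `7062`,
`KadiriStrip3.regionAbove_initial`, no numerical input); and (i), (ii) are served by the Riemann
hypothesis up to height `101`, which is PROVED in the tree by a kernel-checked Backlund–Turing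
certificate (`riemannHypothesisUpTo_hundredOne`, `RiemannHypothesisUpTo101.lean`: `N(101) = 29`, all
on the line). The small splitting height `t₀ = 100 ≤ 101` that this forces is affordable because
the far-zero remainder of Kadiri's Lemma 3.2 is taken to THIRD order
(`KadiriThirdOrderRemainder.lean`: `|H| ≤ M₃(x/η)η³/|z|³`, using the fourth (H₁) condition
`h''(d₁) = 0` of the kernel), which makes the tail over `|γ − kγ₀| ≥ t₀` negligible already at
`t₀ = 100` with the tree's crude zero-counting bounds. Four certified rounds
(`KadiriNumerics3.round_r1 … round_r4`, certificates `KadiriNumerics3Round{1,…,4}{A,B,C}.lean` at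
`θ₀ = 1.13331020`, `K = 16`, `b = mtA16`, `δ = 0.62`, certification height `3·10¹² − 300`)

  `7062 (above 3·10¹² − 400) → 6.4 (above 3·10¹² − 300) → 5.66 (above 3·10¹² − 200)
     → 5.57 (above 3·10¹² − 100) → strip (3·10¹², 5.558691, 5.57) empty`

then give the fact (`KadiriStrip3.large_height_of_stripEmpty`). The printed constants of §9
(`R₀ = 5.5586904517` after seven rounds from `R = 5.573412`, Table 4) are not reproduced; the tree's
cruder error terms still certify `r = 5.558691` at the fourth round (certified (N1) margins
`−12.0, −7.8, −7.9, −7.9`).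

## References

* M. J. Mossinghoff, T. S. Trudgian, A. Yang, *Explicit zero-free regions for the Riemann
  zeta-function*, Res. Number Theory 10 (2024) = arXiv:2212.06867, Theorem 1.3 and §9, Table 4.
  [MossinghoffTrudgianYangRNT2024]
* M. J. Mossinghoff, T. S. Trudgian, J. Number Theory 157 (2015) = arXiv:1410.3926, (2.2), (3.1),
  §§4–5. [MossinghoffTrudgian2015]
* H. Kadiri, Acta Arith. 117 (2005) = arXiv:math/0401238, §§2–4. [Kadiri2005]
-/

noncomputable section

open Real

namespace Literature.NumberTheory.LFunctions

/-- `4480 + 74172/log T ≤ 7062` for `T = 3·10¹² − 400` (`log T ≥ log(3·10¹²) − 10⁻⁹ ≥ 28.7296`).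
[cite: MossinghoffTrudgianYangRNT2024, §9] -/
theorem KadiriNumerics3.initial_constant_le :
    (4480 : ℝ) + 74172 / Real.log (3 * 10 ^ 12 - 400) ≤ 7062 := by
  have hl2a := Real.log_two_gt_d9
  have hl3 := KadiriNumerics.log_3_bounds
  have hl5 := KadiriNumerics.log_5_bounds
  have hT : Real.log (3 * 10 ^ 12) = Real.log 3 + 12 * (Real.log 2 + Real.log 5) := by
    rw [Real.log_mul (by norm_num) (by norm_num), Real.log_pow, show (10 : ℝ) = 2 * 5 by norm_num,
      Real.log_mul (by norm_num) (by norm_num)]; push_cast; ring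
  have hTa : Real.log (3 * 10 ^ 12) - 1 / 10 ^ 9 ≤ Real.log (3 * 10 ^ 12 - 400) := by
    have h := Real.log_le_sub_one_of_pos (by norm_num : (0 : ℝ) < 3 * 10 ^ 12 / (3 * 10 ^ 12 - 400))
    rw [Real.log_div (by norm_num) (by norm_num)] at h
    have : (3 * 10 ^ 12 / (3 * 10 ^ 12 - 400) : ℝ) - 1 ≤ 1 / 10 ^ 9 := by norm_num
    linarith
  have hlow : (28.7296 : ℝ) ≤ Real.log (3 * 10 ^ 12 - 400) := by
    rw [hT] at hTa; linarith [hl3.1, hl5.1]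
  have h1 : (74172 : ℝ) / Real.log (3 * 10 ^ 12 - 400) ≤ 74172 / 28.7296 :=
    div_le_div_of_nonneg_left (by norm_num) (by norm_num) hlow
  have h2 : (74172 : ℝ) / 28.7296 ≤ 2582 := by norm_num
  linarith

/-- **The Mossinghoff–Trudgian–Yang zero-free region at large height** (leaf (B) of Theorem 1.3,
discharged): `ζ(σ + it) ≠ 0` for `t > 3·10¹²` and `σ ≥ 1 − 1/(5.558691 log t)`. Inputs: the
tree's explicit region above `3·10¹² − 400` (constant `7062`), the Riemann hypothesis up to height
`101` (`riemannHypothesisUpTo_hundredOne`, kernel-checked), and the four certified rounds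
`KadiriNumerics3.round_r1, …, round_r4` of Kadiri's method with `t₀ = 100` and the third-order
far-zero remainder. [cite: MossinghoffTrudgianYangRNT2024, Theorem 1.3 and §9] -/
theorem zero_free_region_mossinghoff_trudgian_yang_large_height_holds :
    zero_free_region_mossinghoff_trudgian_yang_large_height := by
  have hRH := KadiriStrip3.rh_two_sided riemannHypothesisUpTo_hundredOne
  -- the initial region: constant `7062` above `3·10¹² − 400`
  have hR0 := KadiriStrip3.regionAbove_initial (T := 3 * 10 ^ 12 - 400) (R₀ := 7062) (by norm_num)
    KadiriNumerics3.initial_constant_le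
  -- round 1: `7062 → 6.4` above `3·10¹² − 300`
  have hE1 := KadiriNumerics3.round_r1 (T_R := 3 * 10 ^ 12 - 400) (T₀ := 3 * 10 ^ 12 - 300) (H := 101)
    (by norm_num) (by norm_num) (by norm_num) (by norm_num) hR0 hRH
  have hR1 := KadiriStrip3.regionAbove_of_stripEmpty hR0 (by norm_num) hE1
  -- round 2: `6.4 → 5.66` above `3·10¹² − 200`
  have hE2 := KadiriNumerics3.round_r2 (T_R := 3 * 10 ^ 12 - 300) (T₀ := 3 * 10 ^ 12 - 200) (H := 101)
    (by norm_num) (by norm_num) (by norm_num) (by norm_num) hR1 hRH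
  have hR2 := KadiriStrip3.regionAbove_of_stripEmpty hR1 (by norm_num) hE2
  -- round 3: `5.66 → 5.57` above `3·10¹² − 100`
  have hE3 := KadiriNumerics3.round_r3 (T_R := 3 * 10 ^ 12 - 200) (T₀ := 3 * 10 ^ 12 - 100) (H := 101)
    (by norm_num) (by norm_num) (by norm_num) (by norm_num) hR2 hRH
  have hR3 := KadiriStrip3.regionAbove_of_stripEmpty hR2 (by norm_num) hE3
  -- round 4: the strip `(3·10¹², 5.558691, 5.57)` is empty
  have hE4 := KadiriNumerics3.round_r4 (T_R := 3 * 10 ^ 12 - 100) (T₀ := 3 * 10 ^ 12) (H := 101)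
    (by norm_num) (by norm_num) (by norm_num) (by norm_num) hR3 hRH
  exact KadiriStrip3.large_height_of_stripEmpty hR3 (by norm_num) hE4

end Literature.NumberTheory.LFunctions
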